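import Mathlib
import Literature.Analysis.SpecialFunctions.BesselHeatKernel
import HarnessLib

/-!
# Radial heat kernels of real index: a priori bounds for the derivatives and behaviour at `z → 0⁺`

Quantitative companions of `BesselHeatKernel.lean` (`q^{(κ)}_τ(x,z) = τ⁻¹e^{-(x²+z²)/2τ} I_κ(xz/τ)`, `κ ≥ 0`), needed for the
Green's-identity / Duhamel comparison of kernels of different index:
* `besselP_succ_le`, `mul_besselP_add_two_le`, `besselP_monotoneOn` — `P_{κ+1} ≤ P_κ`, `U P_{κ+2}(U) ≤ P_κ(U)`, `P_κ` increasing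
  on `[0,∞)` (termwise / contiguity relation);
* `abs_besselHeatDt_le`, `abs_besselHeatDy_le` — the `t`- and `z`-derivatives are bounded by the KERNEL ITSELF times an explicit
  rational function: `|∂_t q| ≤ q·((1+κ)/τ + (x²+z²)/(2τ²) + 2U/τ)`, `|∂_z q| ≤ q·(κ/z + z/τ + 2U/z)`, `U = (xz/2τ)²`;
* `besselHeatKernel_le_rpow_near_zero`, `abs_besselHeatDy_le_near_zero` — on `0 < z ≤ 1`: `q ≤ C z^κ`,
  `|∂_z q| ≤ C z^κ (κ/z + C')`, whence the Wronskian-type boundary term `z (f′g - f g′)` of two kernels of indices `μ, ν` with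
  `μ + ν > 0` tends to `0` as `z → 0⁺` (`tendsto_wronskian_zero`).
[RevuzYor1999, Ch. XI §1; DLMF §10.25.]

## References
* D. Revuz, M. Yor, *Continuous Martingales and Brownian Motion*, 3rd ed. (1999), Ch. XI §1. [RevuzYor1999]
* NIST DLMF §10.25. [DLMF]
-/

noncomputable section

open Filter Topology Real Set
open scoped Nat BigOperators

namespace Literature.Analysis.SpecialFunctions

/-! ## Comparison of the series `P_κ` -/

/-- `P_{κ+1}(u) ≤ P_κ(u)` for `u ≥ 0`, `κ ≥ 0` (termwise: `Γ(k+κ+2) = (k+κ+1)Γ(k+κ+1) ≥ Γ(k+κ+1)`). [cite: DLMF, 10.25.2] -/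
theorem besselP_succ_le {κ : ℝ} (hκ : 0 ≤ κ) {u : ℝ} (hu : 0 ≤ u) : besselP (κ + 1) u ≤ besselP κ u := by
  refine hasSum_le (fun k => ?_) (hasSum_besselP (by linarith) u) (hasSum_besselP hκ u)
  refine mul_le_mul_of_nonneg_right ?_ (pow_nonneg hu k)
  unfold besselPCoeff
  have hpos : 0 < (k : ℝ) + κ + 1 := by positivity
  have hG : 0 < Real.Gamma ((k : ℝ) + κ + 1) := Real.Gamma_pos_of_pos hpos
  have hk : (0 : ℝ) < k ! := by exact_mod_cast Nat.factorial_pos k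
  rw [show (k : ℝ) + (κ + 1) + 1 = ((k : ℝ) + κ + 1) + 1 by ring, Real.Gamma_add_one hpos.ne']
  refine one_div_le_one_div_of_le (by positivity) ?_
  have h1 : 1 ≤ (k : ℝ) + κ + 1 := by linarith [(Nat.cast_nonneg k : (0 : ℝ) ≤ k)]
  exact mul_le_mul_of_nonneg_left (le_mul_of_one_le_left hG.le h1) hk.le

/-- `U · P_{κ+2}(U) ≤ P_κ(U)` for `U ≥ 0`, `κ ≥ 0` (contiguity relation). [cite: DLMF, 10.25.1] -/
theorem mul_besselP_add_two_le {κ : ℝ} (hκ : 0 ≤ κ) {u : ℝ} (hu : 0 ≤ u) : u * besselP (κ + 2) u ≤ besselP κ u := by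
  have h := besselP_three_term hκ u
  have h1 : 0 ≤ (κ + 1) * besselP (κ + 1) u := mul_nonneg (by linarith) (besselP_pos (by linarith) hu).le
  linarith

/-- `P_κ` is non-decreasing on `[0,∞)` (its derivative `P_{κ+1}` is positive there). [cite: DLMF, 10.25.2] -/
theorem besselP_monotoneOn {κ : ℝ} (hκ : 0 ≤ κ) : MonotoneOn (besselP κ) (Ici 0) := by
  refine monotoneOn_of_deriv_nonneg (convex_Ici 0) (continuous_besselP hκ).continuousOn
    (fun u _ => (differentiable_besselP hκ u).differentiableWithinAt) fun u hu => ?_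
  rw [interior_Ici] at hu
  rw [deriv_besselP hκ]
  exact (besselP_pos (by linarith) (le_of_lt hu)).le

/-! ## Derivative bounds in terms of the kernel -/

section DerivBounds

variable {κ τ x z : ℝ}

/-- **`|∂_t q| ≤ q · ((1+κ)/τ + (x²+z²)/(2τ²) + 2U/τ)`** (`U = (xz/2τ)²`). [cite: RevuzYor1999, Ch. XI §1] -/
theorem abs_besselHeatDt_le (hκ : 0 ≤ κ) (hτ : 0 < τ) (hx : 0 < x) (hz : 0 < z) :
    |besselHeatDt κ τ x z| ≤ besselHeatKernel κ τ x z *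
      ((1 + κ) / τ + (x ^ 2 + z ^ 2) / (2 * τ ^ 2) + 2 * besselHeatArg τ x z / τ) := by
  rw [besselHeatKernel_eq_pre_mul]
  unfold besselHeatDt
  set U := besselHeatArg τ x z
  have hU : 0 ≤ U := by unfold U besselHeatArg; positivity
  have hA : 0 < besselHeatPre κ τ x z := besselHeatPre_pos κ hτ hx hz
  have hP : 0 < besselP κ U := besselP_pos hκ hU
  have hP1 : 0 ≤ besselP (κ + 1) U := (besselP_pos (by linarith) hU).le
  have hP1le : besselP (κ + 1) U ≤ besselP κ U := besselP_succ_le hκ hU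
  rw [abs_mul, abs_of_pos hA, mul_assoc]
  refine mul_le_mul_of_nonneg_left ?_ hA.le
  have h1 : |(-(1 + κ) / τ + (x ^ 2 + z ^ 2) / (2 * τ ^ 2)) * besselP κ U| ≤
      ((1 + κ) / τ + (x ^ 2 + z ^ 2) / (2 * τ ^ 2)) * besselP κ U := by
    rw [abs_mul, abs_of_pos hP]
    refine mul_le_mul_of_nonneg_right ?_ hP.le
    refine (abs_add_le _ _).trans ?_
    rw [abs_of_nonpos (by apply div_nonpos_of_nonpos_of_nonneg <;> [linarith; exact hτ.le]),
      abs_of_nonneg (by positivity)]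
    have : -(-(1 + κ) / τ) = (1 + κ) / τ := by ring
    rw [this]
  have h2 : |2 * U / τ * besselP (κ + 1) U| ≤ 2 * U / τ * besselP κ U := by
    rw [abs_of_nonneg (by positivity)]
    exact mul_le_mul_of_nonneg_left hP1le (by positivity)
  calc |(-(1 + κ) / τ + (x ^ 2 + z ^ 2) / (2 * τ ^ 2)) * besselP κ U - 2 * U / τ * besselP (κ + 1) U|
      ≤ |(-(1 + κ) / τ + (x ^ 2 + z ^ 2) / (2 * τ ^ 2)) * besselP κ U| + |2 * U / τ * besselP (κ + 1) U| := abs_sub _ _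
    _ ≤ ((1 + κ) / τ + (x ^ 2 + z ^ 2) / (2 * τ ^ 2)) * besselP κ U + 2 * U / τ * besselP κ U := add_le_add h1 h2
    _ = besselP κ U * ((1 + κ) / τ + (x ^ 2 + z ^ 2) / (2 * τ ^ 2) + 2 * U / τ) := by ring

/-- **`|∂_z q| ≤ q · (κ/z + z/τ + 2U/z)`** (`U = (xz/2τ)²`; derivative in the last variable). [cite: RevuzYor1999, Ch. XI §1] -/
theorem abs_besselHeatDy_le (hκ : 0 ≤ κ) (hτ : 0 < τ) (hx : 0 < x) (hz : 0 < z) :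
    |besselHeatDy κ τ x z| ≤ besselHeatKernel κ τ x z * (κ / z + z / τ + 2 * besselHeatArg τ x z / z) := by
  rw [besselHeatKernel_eq_pre_mul]
  unfold besselHeatDy
  set U := besselHeatArg τ x z
  have hU : 0 ≤ U := by unfold U besselHeatArg; positivity
  have hA : 0 < besselHeatPre κ τ x z := besselHeatPre_pos κ hτ hx hz
  have hP : 0 < besselP κ U := besselP_pos hκ hU
  have hP1 : 0 ≤ besselP (κ + 1) U := (besselP_pos (by linarith) hU).le
  have hP1le : besselP (κ + 1) U ≤ besselP κ U := besselP_succ_le hκ hU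
  rw [abs_mul, abs_of_pos hA, mul_assoc]
  refine mul_le_mul_of_nonneg_left ?_ hA.le
  have h1 : |(κ / z - z / τ) * besselP κ U| ≤ (κ / z + z / τ) * besselP κ U := by
    rw [abs_mul, abs_of_pos hP]
    refine mul_le_mul_of_nonneg_right ((abs_sub _ _).trans ?_) hP.le
    rw [abs_of_nonneg (by positivity), abs_of_nonneg (by positivity)]
  have h2 : |2 * U / z * besselP (κ + 1) U| ≤ 2 * U / z * besselP κ U := by
    rw [abs_of_nonneg (by positivity)]
    exact mul_le_mul_of_nonneg_left hP1le (by positivity)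
  calc |(κ / z - z / τ) * besselP κ U + 2 * U / z * besselP (κ + 1) U|
      ≤ |(κ / z - z / τ) * besselP κ U| + |2 * U / z * besselP (κ + 1) U| := abs_add_le _ _
    _ ≤ (κ / z + z / τ) * besselP κ U + 2 * U / z * besselP κ U := add_le_add h1 h2
    _ = besselP κ U * (κ / z + z / τ + 2 * U / z) := by ring

end DerivBounds

/-! ## Behaviour as `z → 0⁺` -/

section NearZero

variable {κ τ x : ℝ}

/-- **Near `z = 0` the kernel is `O(z^κ)`**: for `0 < z ≤ 1`,
`q^{(κ)}_τ(x,z) ≤ [τ⁻¹ (x/(2τ))^κ P_κ((x/(2τ))²)] · z^κ`. [cite: RevuzYor1999, Ch. XI §1] -/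
theorem besselHeatKernel_le_rpow_near_zero (hκ : 0 ≤ κ) (hτ : 0 < τ) (hx : 0 < x) {z : ℝ} (hz : 0 < z) (hz1 : z ≤ 1) :
    besselHeatKernel κ τ x z ≤ (τ⁻¹ * (x / (2 * τ)) ^ κ * besselP κ ((x / (2 * τ)) ^ 2)) * z ^ κ := by
  rw [besselHeatKernel_eq_pre_mul]
  unfold besselHeatPre besselHeatArg
  have hU : (x * z / (2 * τ)) ^ 2 ≤ (x / (2 * τ)) ^ 2 := by
    have h0 : 0 ≤ x * z / (2 * τ) := by positivity
    have h1 : x * z / (2 * τ) ≤ x / (2 * τ) := by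
      rw [div_le_div_iff_of_pos_right (by positivity)]
      nlinarith
    exact pow_le_pow_left₀ h0 h1 2
  have hPmono := besselP_monotoneOn hκ (show (0 : ℝ) ≤ (x * z / (2 * τ)) ^ 2 by positivity)
    (show (0 : ℝ) ≤ (x / (2 * τ)) ^ 2 by positivity) hU
  have hexp : Real.exp (-(x ^ 2 + z ^ 2) / (2 * τ)) ≤ 1 := by
    rw [Real.exp_le_one_iff]
    apply div_nonpos_of_nonpos_of_nonneg <;> [nlinarith [sq_nonneg x, sq_nonneg z]; positivity]
  have hrpow : (x * z / (2 * τ)) ^ κ = (x / (2 * τ)) ^ κ * z ^ κ := by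
    rw [show x * z / (2 * τ) = (x / (2 * τ)) * z by ring, Real.mul_rpow (by positivity) hz.le]
  rw [hrpow]
  have hP0 : 0 ≤ besselP κ ((x * z / (2 * τ)) ^ 2) := (besselP_pos hκ (by positivity)).le
  calc τ⁻¹ * Real.exp (-(x ^ 2 + z ^ 2) / (2 * τ)) * ((x / (2 * τ)) ^ κ * z ^ κ) * besselP κ ((x * z / (2 * τ)) ^ 2)
      ≤ τ⁻¹ * 1 * ((x / (2 * τ)) ^ κ * z ^ κ) * besselP κ ((x / (2 * τ)) ^ 2) := by
        gcongr
    _ = (τ⁻¹ * (x / (2 * τ)) ^ κ * besselP κ ((x / (2 * τ)) ^ 2)) * z ^ κ := by ring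

/-- **Near `z = 0` the `z`-derivative is `O(z^{κ-1})`** (`O(z)` if `κ = 0`): for `0 < z ≤ 1`,
`|∂_z q^{(κ)}_τ(x,z)| ≤ [τ⁻¹ (x/(2τ))^κ P_κ((x/(2τ))²)] · z^κ · (κ/z + 1/τ + x²/(2τ²))`. [cite: RevuzYor1999, Ch. XI §1] -/
theorem abs_besselHeatDy_le_near_zero (hκ : 0 ≤ κ) (hτ : 0 < τ) (hx : 0 < x) {z : ℝ} (hz : 0 < z) (hz1 : z ≤ 1) :
    |besselHeatDy κ τ x z| ≤
      (τ⁻¹ * (x / (2 * τ)) ^ κ * besselP κ ((x / (2 * τ)) ^ 2)) * z ^ κ * (κ / z + 1 / τ + x ^ 2 / (2 * τ ^ 2)) := by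
  have h1 := abs_besselHeatDy_le hκ hτ hx hz
  have h2 := besselHeatKernel_le_rpow_near_zero hκ hτ hx hz hz1
  have hfac : κ / z + z / τ + 2 * besselHeatArg τ x z / z ≤ κ / z + 1 / τ + x ^ 2 / (2 * τ ^ 2) := by
    unfold besselHeatArg
    have e : 2 * (x * z / (2 * τ)) ^ 2 / z = x ^ 2 / (2 * τ ^ 2) * z := by
      field_simp
    rw [e]
    have a1 : z / τ ≤ 1 / τ := div_le_div_of_nonneg_right hz1 hτ.le
    have a2 : x ^ 2 / (2 * τ ^ 2) * z ≤ x ^ 2 / (2 * τ ^ 2) := mul_le_of_le_one_right (by positivity) hz1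
    linarith
  have hq : 0 ≤ besselHeatKernel κ τ x z := (besselHeatKernel_pos hκ hτ hx hz).le
  calc |besselHeatDy κ τ x z| ≤ besselHeatKernel κ τ x z * (κ / z + z / τ + 2 * besselHeatArg τ x z / z) := h1
    _ ≤ besselHeatKernel κ τ x z * (κ / z + 1 / τ + x ^ 2 / (2 * τ ^ 2)) := mul_le_mul_of_nonneg_left hfac hq
    _ ≤ _ := mul_le_mul_of_nonneg_right h2 (by positivity)

/-- **The Wronskian boundary term vanishes at `0`**: for kernels `f = q^{(ν)}_τ(x,·)`, `g = q^{(μ)}_s(y,·)` with `μ, ν ≥ 0`,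
`μ + ν > 0`, the quantity `z · (f′(z) g(z) - f(z) g′(z))` tends to `0` as `z → 0⁺`. [cite: RevuzYor1999, Ch. XI §1] -/
theorem tendsto_wronskian_zero {μ ν τ s x y : ℝ} (hμ : 0 ≤ μ) (hν : 0 ≤ ν) (hμν : 0 < μ + ν)
    (hτ : 0 < τ) (hs : 0 < s) (hx : 0 < x) (hy : 0 < y) :
    Tendsto (fun z : ℝ => z * (besselHeatDy ν τ x z * besselHeatKernel μ s y z
      - besselHeatKernel ν τ x z * besselHeatDy μ s y z)) (𝓝[>] 0) (𝓝 0) := by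
  -- constants of the near-zero bounds
  set Cf : ℝ := τ⁻¹ * (x / (2 * τ)) ^ ν * besselP ν ((x / (2 * τ)) ^ 2) with hCf
  set Cg : ℝ := s⁻¹ * (y / (2 * s)) ^ μ * besselP μ ((y / (2 * s)) ^ 2) with hCg
  set Af : ℝ := 1 / τ + x ^ 2 / (2 * τ ^ 2) with hAf
  set Ag : ℝ := 1 / s + y ^ 2 / (2 * s ^ 2) with hAg
  have hCf0 : 0 ≤ Cf := by
    have := (besselP_pos hν (show (0:ℝ) ≤ (x / (2 * τ)) ^ 2 by positivity)).le
    positivity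
  have hCg0 : 0 ≤ Cg := by
    have := (besselP_pos hμ (show (0:ℝ) ≤ (y / (2 * s)) ^ 2 by positivity)).le
    positivity
  -- the bound `|W(z)| ≤ Cf Cg z^{μ+ν} ((ν + μ) + (Af + Ag) z)` on `0 < z ≤ 1`
  have hbound : ∀ z : ℝ, 0 < z → z ≤ 1 →
      |z * (besselHeatDy ν τ x z * besselHeatKernel μ s y z - besselHeatKernel ν τ x z * besselHeatDy μ s y z)| ≤
        Cf * Cg * (z ^ (μ + ν) * ((ν + μ) + (Af + Ag) * z)) := by
    intro z hz hz1
    have hf := besselHeatKernel_le_rpow_near_zero hν hτ hx hz hz1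
    have hg := besselHeatKernel_le_rpow_near_zero hμ hs hy hz hz1
    have hf' := abs_besselHeatDy_le_near_zero hν hτ hx hz hz1
    have hg' := abs_besselHeatDy_le_near_zero hμ hs hy hz hz1
    have hf0 : 0 ≤ besselHeatKernel ν τ x z := (besselHeatKernel_pos hν hτ hx hz).le
    have hg0 : 0 ≤ besselHeatKernel μ s y z := (besselHeatKernel_pos hμ hs hy hz).le
    rw [abs_mul, abs_of_pos hz]
    have hprod1 : |besselHeatDy ν τ x z| * besselHeatKernel μ s y z ≤
        (Cf * z ^ ν * (ν / z + Af)) * (Cg * z ^ μ) := by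
      refine mul_le_mul ?_ hg (hg0) (by positivity)
      simpa [hCf, hAf, add_assoc] using hf'
    have hprod2 : besselHeatKernel ν τ x z * |besselHeatDy μ s y z| ≤
        (Cf * z ^ ν) * (Cg * z ^ μ * (μ / z + Ag)) := by
      refine mul_le_mul hf ?_ (abs_nonneg _) (by positivity)
      simpa [hCg, hAg, add_assoc] using hg'
    have hzpow : z ^ ν * z ^ μ = z ^ (μ + ν) := by rw [← Real.rpow_add hz]; ring_nf
    calc z * |besselHeatDy ν τ x z * besselHeatKernel μ s y z - besselHeatKernel ν τ x z * besselHeatDy μ s y z|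
        ≤ z * (|besselHeatDy ν τ x z| * besselHeatKernel μ s y z + besselHeatKernel ν τ x z * |besselHeatDy μ s y z|) := by
          refine mul_le_mul_of_nonneg_left ((abs_sub _ _).trans ?_) hz.le
          rw [abs_mul, abs_mul, abs_of_nonneg hg0, abs_of_nonneg hf0]
      _ ≤ z * ((Cf * z ^ ν * (ν / z + Af)) * (Cg * z ^ μ) + (Cf * z ^ ν) * (Cg * z ^ μ * (μ / z + Ag))) := by
          exact mul_le_mul_of_nonneg_left (add_le_add hprod1 hprod2) hz.le
      _ = Cf * Cg * (z ^ ν * z ^ μ) * (z * (ν / z + Af) + z * (μ / z + Ag)) := by ring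
      _ = Cf * Cg * (z ^ (μ + ν) * ((ν + μ) + (Af + Ag) * z)) := by
          rw [hzpow]; field_simp; ring
  -- the bound tends to `0`
  have hlim : Tendsto (fun z : ℝ => Cf * Cg * (z ^ (μ + ν) * ((ν + μ) + (Af + Ag) * z))) (𝓝[>] 0) (𝓝 0) := by
    have h1 : Tendsto (fun z : ℝ => z ^ (μ + ν)) (𝓝[>] 0) (𝓝 0) := by
      have h := ((Real.continuous_rpow_const hμν.le).tendsto (0 : ℝ)).mono_left
        (nhdsWithin_le_nhds (s := Ioi (0 : ℝ)))
      rwa [Real.zero_rpow hμν.ne'] at h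
    have h2 : Tendsto (fun z : ℝ => (ν + μ) + (Af + Ag) * z) (𝓝[>] 0) (𝓝 ((ν + μ) + (Af + Ag) * 0)) :=
      ((tendsto_const_nhds.add (tendsto_const_nhds.mul tendsto_id)).mono_left nhdsWithin_le_nhds)
    have := (h1.mul h2).const_mul (Cf * Cg)
    simpa using this
  refine squeeze_zero_norm' ?_ hlim
  filter_upwards [Ioo_mem_nhdsGT one_pos] with z hz
  rw [Real.norm_eq_abs]
  exact hbound z hz.1 hz.2.le

end NearZero

end Literature.Analysis.SpecialFunctions

end
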